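/-
Copyright: the b2b-balaban cell (near-miss cell 7), T⁴-continuum fan-out, lineage t4-ne7b-p1 (node U5c COUNT member).
Released under the licence of the surrounding project.
-/
import Summits.QuantumFields.BalabanUV.T4Continuum.Support.PartnerMultiplicityF
import Summits.QuantumFields.BalabanUV.T4Continuum.Support.PlacementSkeleton

/-!
# The count member's chain with a CLASS-LINEAR surcharge in the multiplicity binder (`hlabG`)

Summits-side support leaf of the T⁴-continuum cell (rung (B)+1 on a FINITE torus only; NOT infinite volume, NOT the
mass gap, NOT the Clay statement; NOT a proof of the spine estimate NE7b).  Lineage `t4-ne7b-p1`, node U5c, wall (GM),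
located item G-ne7bp1g18-2 — the binder owner's half, second re-typing.  [folklore] bookkeeping over the lineage's
OWN typed carrier; nothing is quoted from print and nothing printed is asserted.

WHAT.  The tree's `T4PartnerMultiplicity.exists_irThreshold_relWeightBoundM` asks, per live slot, for a consistent
genealogy `G` with `y ≤ Λ′^{partnerAges G}·e^{−credits}·e^{+lifeCost}`; `Support/PartnerMultiplicityF` allowed the
batch factorials `∏_t n_t(G)!`.  Every multiplicity surcharge the placement assembly actually produces — batch
factorials (parts 3∕3b), per-birth constants, and the zone crowding `∏_Z q_Z^d` of the zone form (crowding theorem,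
`Support/Crowding*.lean`) — is dominated by ONE shape: a CLASS-LINEAR exponential `exp(θ·Σ_{births}(d′ + 1))` (a
constant `c ≥ 1` per birth is `exp(log c·#births) ≤ exp(log c·Σ(d′+1))`; the crowding theorem's output is
`exp((θ + 2·crowdA)·Σ(d′+1))·(e^{ε})^{partnerAges}`, and `(e^{ε})^{partnerAges}` merges into `Λ′`).  This file
states the chain with the binder

  `hlabG`:  `y ≤ 0 ∨ ∃ G, Consistent ∧ WF ∧ rootStep = j ∧ K < reach ∧ root = b ∧ events ∖ root = Q ∧`
            `y ≤ exp(θ·Σ_{b′ ∈ births G} (d′_{b′} + 1)) · Λ′^{partnerAges G} · e^{−credits (credit C g_K) G}`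
            `    · e^{+lifeCost G}`

and proves it from the landed theorem VERBATIM, run at the lowered quadratic birth constant `lowerA C θ`
(`Support/PlacementBatchCredits.credits_lowerA_add_le`: with the profile floor `p₀(g_s) ≥ 1` at birth steps, the
class-linear surcharge is exactly what lowering `a` by `θ` releases).  DISPLAYED BINDERS that differ from the landed
statement: `1 ≤ C.A₀` (was `0 <`; gives the profile floor under the run regime `1 ≤ log (g²)⁻¹`,
`PartnerMultiplicityF.one_le_p0Profile`) and `0 ≤ θ`, `θ < C.a` (was `0 < C.a`).  §1 also records, for the consumers,
that a `Consistent` genealogy has the step data, the order and the kinds the crowding theorem asks for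
(`stepsOK_of_consistent`, `ordered_of_consistent`, `kind_eq_zero_of_mem_births`).

WHAT THIS FILE DOES NOT DO.  It does not inhabit `hlabG` (the zone skeleton instantiated behind the reading (ID),
G-ne7bp1g9-1, plus the crowding conversion `Support/PartnerMultiplicityZ`); whether print's `a` (CONTEXT: `½γ₀A₁²` of
(1.79)) has the room `θ` is an (E2)-side constant, not decided here.  NE7b discharge: no date.

HONEST DEPENDENCY (cell): continuum YM on T⁴ ⇐ BetaPertH ∧ nine spine estimates (0/9 proved); BetaPertH ⇐ (D1) ∧ (D4)
∧ CAP+tail.  This file changes none of it.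
-/

open Finset
open Literature.MathematicalPhysics.QuantumFieldTheory.Balaban1983to89
open T4PersistenceDictionary T4PersistentHistoryCount T4BankedInduction T4PrintedShapeBanking
open T4WeightBudget T4GlobalDenominator T4LiveClassFibration T4LiveStructureGas T4LiveGasToTerms T4RecordPriceSeam
open T4PartnerMultiplicity
open Summit.QuantumFields.BalabanUV.T4Continuum.PlacementBatch
open Summit.QuantumFields.BalabanUV.T4Continuum.PlacementSkeleton
open Summit.QuantumFields.BalabanUV.T4Continuum.PartnerMultiplicityF

namespace Summit.QuantumFields.BalabanUV.T4Continuum.PartnerMultiplicityG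

noncomputable section

/-! ## §1 What a consistent genealogy gives the crowding theorem -/

/-- A consistent genealogy has consistent step data: every leaf `born b j` has `b.step = j`. [folklore] -/
theorem stepsOK_of_consistent {C : T4PrintedShapeBanking.Consts} {K : ℕ} {R : ℕ → ℕ} :
    ∀ {G : Gen PEv}, Consistent C K R G → StepsOK PEv.step G
  | Gen.born b j, hc => by
      simp only [Consistent] at hc
      exact hc.2.1
  | Gen.renew G e h, hc => by
      simp only [Consistent] at hc
      exact stepsOK_of_consistent (G := G) hc.1
  | Gen.merge X Y e, hc => by
      simp only [Consistent] at hc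
      exact ⟨stepsOK_of_consistent hc.1, stepsOK_of_consistent hc.2.1⟩

/-- A consistent genealogy is ordered (indeed `rootStep ≤ step e` at every merger). [folklore] -/
theorem ordered_of_consistent {C : T4PrintedShapeBanking.Consts} {K : ℕ} {R : ℕ → ℕ} :
    ∀ {G : Gen PEv}, Consistent C K R G → Ordered PEv.step G
  | Gen.born b j, _ => trivial
  | Gen.renew G e h, hc => by
      simp only [Consistent] at hc
      exact ordered_of_consistent (G := G) hc.1
  | Gen.merge X Y e, hc => by
      simp only [Consistent] at hc
      obtain ⟨hX, hY, -, hx, -, hy, -, -⟩ := hc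
      exact ⟨ordered_of_consistent hX, ordered_of_consistent hY, Nat.le_succ_of_le hx, Nat.le_succ_of_le hy⟩

/-- The births of a consistent genealogy have kind `0`. [folklore] -/
theorem kind_eq_zero_of_mem_births {C : T4PrintedShapeBanking.Consts} {K : ℕ} {R : ℕ → ℕ} :
    ∀ {G : Gen PEv}, Consistent C K R G → ∀ b ∈ births G, b.kind = 0
  | Gen.born b j, hc, b', hb' => by
      simp only [Consistent] at hc
      simp only [births_born, mem_singleton] at hb'
      subst hb'
      exact hc.1
  | Gen.renew G e h, hc, b', hb' => by
      simp only [Consistent] at hc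
      exact kind_eq_zero_of_mem_births (G := G) hc.1 b' hb'
  | Gen.merge X Y e, hc, b', hb' => by
      simp only [Consistent] at hc
      rcases mem_union.1 hb' with h | h
      · exact kind_eq_zero_of_mem_births hc.1 b' h
      · exact kind_eq_zero_of_mem_births hc.2.1 b' h

/-- hence the births lie among the kind-`0` events [folklore] -/
theorem births_subset_filter {C : T4PrintedShapeBanking.Consts} {K : ℕ} {R : ℕ → ℕ} {G : Gen PEv}
    (hc : Consistent C K R G) : births G ⊆ G.events.filter fun e => e.kind = 0 := fun b hb =>
  mem_filter.2 ⟨births_subset_events G hb, kind_eq_zero_of_mem_births hc b hb⟩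

/-! ## §2 The class-linear surcharge against the credits -/

/-- **A CLASS-LINEAR SURCHARGE IS PAID BY LOWERING `a` BY ITS RATE.**  For a consistent genealogy with the profile
floor at its birth steps and `θ ≥ 0`:
`exp(θ·Σ_{births}(d′+1)) · e^{−credits (credit C g) G} ≤ e^{−credits (credit (lowerA C θ) g) G}`. [folklore] -/
theorem exp_mul_fatSum_mul_exp_neg_credits_le {C : T4PrintedShapeBanking.Consts} {K : ℕ} {R : ℕ → ℕ} {g : ℕ → ℝ}
    {θ : ℝ} (hθ : 0 ≤ θ) {G : Gen PEv} (hc : Consistent C K R G)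
    (hP : ∀ e ∈ G.events, e.kind = 0 → 1 ≤ p0Profile C.A₀ C.p₀ (g e.step)) :
    Real.exp (θ * ∑ b ∈ births G, ((b.fat : ℝ) + 1)) * Real.exp (-credits (credit C g) G) ≤
      Real.exp (-credits (credit (lowerA C θ) g) G) := by
  have h1 := credits_lowerA_add_le hθ G hP
  have h2 : ∑ b ∈ births G, ((b.fat : ℝ) + 1) ≤ ∑ e ∈ G.events.filter (fun e => e.kind = 0), ((e.fat : ℝ) + 1) :=
    sum_le_sum_of_subset_of_nonneg (births_subset_filter hc) fun _ _ _ => by positivity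
  rw [← Real.exp_add, Real.exp_le_exp]
  nlinarith [mul_le_mul_of_nonneg_left h2 hθ]

/-! ## §3 End to end with the class-linear binder -/

section EndToEnd

variable {γ κ ι : Type*} [DecidableEq γ] [DecidableEq κ] {l₀ : ℝ} {K₀ : ℕ} {π : ℕ → ι → κ} {T : ℕ → Finset ι}
  {A A' : ℕ → ℝ → ι → ℝ} {Bad' : ℕ → ℝ → Finset κ} {dead dead' : ℕ → ℝ → ι → ℝ} {F Rf F' Rf' : ℕ → κ → ℝ}
  {nlow nup mlow mup : ℕ → ℝ → ℝ} {Cn : ℝ}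

/-- **END TO END WITH A CLASS-LINEAR MULTIPLICITY SURCHARGE — ONE INFRARED THRESHOLD, THEN THE WEIGHT SLOT.**
`T4PartnerMultiplicity.exists_irThreshold_relWeightBoundM` VERBATIM except: (i) the labelling binder is `hlabG` — the
price of a live slot `(j, z, b, Q)` of cutoff `K` is `≤ 0` or at most
`exp(θ·Σ_{b′ ∈ births G}(d′_{b′} + 1)) · Λ′^{partnerAges G} · e^{−credits (credit C g_K) G} · e^{+lifeCost G}` for SOME
consistent well-formed genealogy `G` born at `j`, pending at `K`, with root `b` and record `Q`; (ii) `1 ≤ C.A₀`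
replaces `0 < C.A₀`; (iii) `0 ≤ θ` and `θ < C.a` replace `0 < C.a`.  SAME threshold shape, SAME budgets, SAME rate
`Λ·e^{η̄ − κ₁} < 1`, SAME `Λ′`-conditions, SAME conclusion.  Proof: the landed theorem at `lowerA C θ`; `hlabG ⇒ hlabM`
there by `exp_mul_fatSum_mul_exp_neg_credits_le` with the profile floor from (ii) and the run regime. [folklore] -/
theorem exists_irThreshold_relWeightBoundG (C : T4PrintedShapeBanking.Consts) (hC : C.Valid) {θ : ℝ} (hθ : 0 ≤ θ)
    (ha : θ < C.a) (hA₀ : 1 ≤ C.A₀) {L r : ℕ} (hL : 1 ≤ L) {β₀ : ℝ} (hβ : 0 ≤ β₀) (hrq : r * (C.q' + 1) < C.p₀)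
    (Cell : ℕ → ℕ → Finset γ) {V Λ : ℝ} (hV : 0 ≤ V) (hΛ : 0 < Λ)
    (hcell : ∀ K a, ((Cell K a).card : ℝ) ≤ V * Λ ^ a) (E B : ℕ → ℕ → Finset PEv)
    (hE : ∀ K j, ∀ e ∈ E K j, PEv.step e ∈ Ioc j K) (jstar : ℕ → ℕ) (hj : ∀ K, jstar K ≤ K) {c : ℝ} (hc : 0 < c)
    (hfrac : ∀ K : ℕ, c * K ≤ ((K - jstar K : ℕ) : ℝ))
    (hA : Regeneration l₀ π T A Bad' dead F Rf nlow nup Cn K₀)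
    (hA' : Regeneration l₀ π T A' Bad' dead' F' Rf' mlow mup Cn K₀) (hCn : 0 ≤ Cn) :
    ∃ x₀ : ℝ, ∀ (R : ℕ → ℕ → ℕ) (g : ℕ → ℕ → ℝ) (β' : ℕ → ℝ),
      (∀ K, K₀ ≤ K → B14.FlowIneq27 (g K) (β' K) β₀ C.p₀ K) →
      (∀ K, K₀ ≤ K → B14FlowStep.FlowIneq29 (R K) (g K) L (β' K) β₀ K) →
      (∀ K, K₀ ≤ K → ∀ s, s ≤ K → B14.IsRj L r (g K s) (R K s)) →
      (∀ K, K₀ ≤ K → ∀ s, s ≤ K → 1 ≤ Real.log ((g K s) ^ 2)⁻¹) →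
      (∀ K, K₀ ≤ K → x₀ ≤ Real.log ((g K K) ^ 2)⁻¹) →
      ∀ {ρbar ηbar : ℝ}, (∀ K j, ∑ b ∈ B K j, rho C (g K) b ≤ ρbar) →
      (∀ K j, ∀ t ∈ Ioc j K, ∑ e ∈ E K j with PEv.step e = t, eta C e ≤ ηbar) →
      Λ * Real.exp (ηbar - C.κ₁) < 1 →
      ∀ {Λ' : ℝ}, 0 ≤ Λ' → Λ' * Real.exp (-C.κ₁) ≤ 1 →
      ∀ (y : ℕ → ℕ → γ → PEv → Finset PEv → ℝ),
      (∀ K, ∀ j ≤ K, ∀ z ∈ Cell K (K - j), ∀ b ∈ B K j,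
        ∀ Q ∈ records (dictW (R K) C.n₁) j K (E K j) b, 0 ≤ y K j z b Q) →
      (∀ K, K₀ ≤ K → ∀ j ≤ K, ∀ z ∈ Cell K (K - j), ∀ b ∈ B K j,
        ∀ Q ∈ records (dictW (R K) C.n₁) j K (E K j) b,
        y K j z b Q ≤ 0 ∨ ∃ G : Gen PEv, Consistent C K (R K) G ∧ G.WF (dictW (R K) C.n₁) ∧ G.rootStep = j ∧
          K < G.reach (dictW (R K) C.n₁) ∧ G.root = b ∧ G.events.erase G.root = Q ∧
          y K j z b Q ≤ Real.exp (θ * ∑ b' ∈ births G, ((b'.fat : ℝ) + 1)) *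
            (Λ' ^ partnerAges PEv.step G * (Real.exp (-credits (credit C (g K)) G) *
              Real.exp (lifeCost (dictW (R K) C.n₁) (cost C K (R K)) G)))) →
      ∀ (str : ℕ → κ → Finset (Slot γ PEv)),
      (∀ K t, |t| ≤ l₀ → K₀ ≤ K → Set.InjOn (str K) (Bad' K t)) →
      (∀ K t, |t| ≤ l₀ → K₀ ≤ K → ∀ c ∈ Bad' K t,
        str K c ⊆ liveSlots Cell (dictW (R K) C.n₁) E B K ∧
          ∃ o ∈ oldSlots Cell (dictW (R K) C.n₁) E B jstar K, o ∈ str K c) →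
      (∀ K t, |t| ≤ l₀ → K₀ ≤ K → ∀ c ∈ Bad' K t, F K c * Rf K c ≤ famWeight (slotPrice (y K)) (str K c)) →
      (∀ K t, |t| ≤ l₀ → K₀ ≤ K → ∀ c ∈ Bad' K t, F' K c * Rf' K c ≤ famWeight (slotPrice (y K)) (str K c)) →
      ∃ K₁, K₀ ≤ K₁ ∧ RelWeightBound l₀ T A A' (fun K t => if K₁ ≤ K then badOfClass π T Bad' K t else ∅)
        (Set.indicator {K | K₁ ≤ K} (fun K => Cn * recordsBudget ρbar C.κ₁ V Λ ηbar jstar K)) := by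
  have hC' : (lowerA C θ).Valid := lowerA_valid hC _
  have ha' : 0 < (lowerA C θ).a := by rw [lowerA_a]; linarith
  have hA₀' : 0 < (lowerA C θ).A₀ := by rw [lowerA_A₀]; linarith
  obtain ⟨x₀, hx₀⟩ := exists_irThreshold_relWeightBoundM (lowerA C θ) hC' ha' hA₀' hL hβ hrq Cell hV hΛ
    hcell E B hE jstar hj hc hfrac hA hA' hCn
  refine ⟨x₀, ?_⟩
  intro R g β' h27 h29 hR hx1 hir ρbar ηbar hρbar hηbar hr Λ' hΛ0 hΛ1 y hy0 hlabG str hinj hstr hF hF'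
  have hlabM : ∀ K, K₀ ≤ K → ∀ j ≤ K, ∀ z ∈ Cell K (K - j), ∀ b ∈ B K j,
      ∀ Q ∈ records (dictW (R K) C.n₁) j K (E K j) b,
      y K j z b Q ≤ 0 ∨ ∃ G : Gen PEv, Consistent (lowerA C θ) K (R K) G ∧ G.WF (dictW (R K) C.n₁) ∧
        G.rootStep = j ∧ K < G.reach (dictW (R K) C.n₁) ∧ G.root = b ∧ G.events.erase G.root = Q ∧
        y K j z b Q ≤ Λ' ^ partnerAges PEv.step G * (Real.exp (-credits (credit (lowerA C θ) (g K)) G) *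
          Real.exp (lifeCost (dictW (R K) C.n₁) (cost C K (R K)) G)) := by
    intro K hK j hj z hz b hb Q hQ
    rcases hlabG K hK j hj z hz b hb Q hQ with h0 | ⟨G, hcG, hW, hrs, hKr, hroot, hQ', hy⟩
    · exact Or.inl h0
    · refine Or.inr ⟨G, (consistent_lowerA_iff C θ K (R K) G).2 hcG, hW, hrs, hKr, hroot, hQ', hy.trans ?_⟩
      have hP : ∀ e ∈ G.events, e.kind = 0 → 1 ≤ p0Profile C.A₀ C.p₀ (g K e.step) := fun e he _ =>
        one_le_p0Profile hA₀ C.p₀ (hx1 K hK e.step (step_le_of_consistent hcG e he))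
      have key := exp_mul_fatSum_mul_exp_neg_credits_le (g := g K) hθ hcG hP
      have hX : 0 ≤ Real.exp (lifeCost (dictW (R K) C.n₁) (cost C K (R K)) G) := (Real.exp_pos _).le
      have hΛp : 0 ≤ Λ' ^ partnerAges PEv.step G := pow_nonneg hΛ0 _
      calc Real.exp (θ * ∑ b' ∈ births G, ((b'.fat : ℝ) + 1)) *
            (Λ' ^ partnerAges PEv.step G * (Real.exp (-credits (credit C (g K)) G) *
              Real.exp (lifeCost (dictW (R K) C.n₁) (cost C K (R K)) G)))
          = Λ' ^ partnerAges PEv.step G *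
              ((Real.exp (θ * ∑ b' ∈ births G, ((b'.fat : ℝ) + 1)) * Real.exp (-credits (credit C (g K)) G)) *
                Real.exp (lifeCost (dictW (R K) C.n₁) (cost C K (R K)) G)) := by ring
        _ ≤ Λ' ^ partnerAges PEv.step G * (Real.exp (-credits (credit (lowerA C θ) (g K)) G) *
              Real.exp (lifeCost (dictW (R K) C.n₁) (cost C K (R K)) G)) :=
            mul_le_mul_of_nonneg_left (mul_le_mul_of_nonneg_right key hX) hΛp
  exact hx₀ R g β' h27 h29 hR hx1 hir hρbar hηbar hr hΛ0 hΛ1 y hy0 hlabM str hinj hstr hF hF'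

end EndToEnd

/-! ## §4 Sanity -/

namespace Sanity

/-- a two-leaf merger typed against the dictionary's `Consistent` has ordered, consistent steps and kind-`0` births:
the three bridges on a decided instance (constants irrelevant: `Consistent` at the leaves reads kind, step, `≤ K`) -/
theorem bridges_example (C : T4PrintedShapeBanking.Consts) (R : ℕ → ℕ)
    (h : Consistent C 5 R (Gen.merge (Gen.born ((0, 0, 2) : PEv) 0) (Gen.born (1, 0, 0) 1) (3, 2, 0))) :
    StepsOK PEv.step (Gen.merge (Gen.born ((0, 0, 2) : PEv) 0) (Gen.born (1, 0, 0) 1) (3, 2, 0)) ∧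
      Ordered PEv.step (Gen.merge (Gen.born ((0, 0, 2) : PEv) 0) (Gen.born (1, 0, 0) 1) (3, 2, 0)) ∧
      ∀ b ∈ births (Gen.merge (Gen.born ((0, 0, 2) : PEv) 0) (Gen.born (1, 0, 0) 1) (3, 2, 0)), PEv.kind b = 0 :=
  ⟨stepsOK_of_consistent h, ordered_of_consistent h, kind_eq_zero_of_mem_births h⟩

/-- the surcharge at `θ = 0` is no surcharge: `exp(0·F)·e^{−credits} ≤ e^{−credits (lowerA C 0)}` (both sides agree
up to `lowerA C 0 = C` on the credits) -/
theorem surcharge_zero {C : T4PrintedShapeBanking.Consts} {K : ℕ} {R : ℕ → ℕ} {g : ℕ → ℝ} {G : Gen PEv}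
    (hc : Consistent C K R G) (hP : ∀ e ∈ G.events, e.kind = 0 → 1 ≤ p0Profile C.A₀ C.p₀ (g e.step)) :
    Real.exp (0 * ∑ b ∈ births G, ((b.fat : ℝ) + 1)) * Real.exp (-credits (credit C g) G) ≤
      Real.exp (-credits (credit (lowerA C 0) g) G) :=
  exp_mul_fatSum_mul_exp_neg_credits_le le_rfl hc hP

end Sanity

end

end Summit.QuantumFields.BalabanUV.T4Continuum.PartnerMultiplicityG
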